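import Literature.Computability.AlgebraicComplexity.TavenasVnWitness
import Literature.Computability.AlgebraicComplexity.PermanentBooleanSum
import HarnessLib

/-!
# Discharge of Tavenas' Corollary 3.37 (`Tavenas2014_cor_3_37_holds`)

The named fact `Literature.Computability.AlgebraicComplexity.Tavenas2014_cor_3_37`
(`RealTauConjectureViaVn.lean`; Tavenas 2014, Cor. 3.37, thesis p. 54: Prop. 3.17 applied to the
`P`-definable family `V_n = ∑_{i<2^n} 2^{2·2^n i - 2i(i+1)} X^i` of Lemme 3.36 — the multilinear bit
polynomial `h_n` of display (3.1) is a projection of `PER_{q(n)}`, `q` p-bounded, and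
`V_n = h_n(X^{2^j}; 2^{2^i})`) is a THEOREM of the tree.

The proof is the composition of

* `Tavenas2014_cor_3_37_of_BCS21_29` (`TavenasVnWitness.lean`): Cor. 3.37 from BCS 1997,
  Thm. (21.29) — the coefficient-bit circuit of `V_n` ("`Bit(v) ∈ P`", thesis p. 54) is written
  down, Valiant's criterion (Prop. 3.10) for this bit language is an explicit polynomial-size
  expression whose Boolean sum is `h_n`, BCS Thm. (21.27) (proved, `PermanentUniversality.lean`)
  turns it into a permanent with the column property, and Thm. (21.29) sums out the Boolean block;
* `BCS1997_thm_21_29_holds ℚ` (`PermanentBooleanSum.lean`): the discharge of BCS Thm. (21.29)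
  (Boolean sums of permanents with the column property are permanents of size `≤ 10 N`,
  characteristic `≠ 2`).

This file cannot be merged into `RealTauConjectureViaVn.lean` (which `TavenasVnWitness.lean`
imports); it is its `…Proofs` sibling.

## References

* S. Tavenas, *Bornes inférieures et supérieures dans les circuits arithmétiques*, PhD thesis,
  ENS Lyon 2014, Prop. 3.10, Prop. 3.17 (p. 45, display (3.1) p. 46), Lemme 3.36 (p. 53),
  Cor. 3.37 (p. 54).
* P. Bürgisser, M. Clausen, M. A. Shokrollahi, *Algebraic Complexity Theory*, Grundlehren 315,
  Springer 1997, Thm. (21.27), Thm. (21.29).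
* L. G. Valiant, *Completeness classes in algebra*, Proc. 11th STOC (1979), 249–261.
-/

namespace Literature.Computability.AlgebraicComplexity

/-- **Tavenas' Corollary 3.37** (discharge of the named fact `Tavenas2014_cor_3_37`): there is a
p-bounded `q` such that, for every `n`, the multilinear bit polynomial
`h_n ∈ ℚ[x_0, …, x_{2n+2}, z_0, …, z_{2n+2}]` of `V_n` is a projection of `PER_{q(n)}` and
`h_n(X^{2^0}, …, X^{2^{2n+2}}; 2^{2^0}, …, 2^{2^{2n+2}}) = V_n` — Prop. 3.17 for the family `(V_n)`
of Lemme 3.36, proved along the printed lines (`Bit(v) ∈ P`, Valiant's criterion,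
`VNP`-completeness of the permanent) from `Tavenas2014_cor_3_37_of_BCS21_29` and the proved
BCS Thm. (21.29) `BCS1997_thm_21_29_holds ℚ`. [cite: Tavenas2014, Cor. 3.37] -/
theorem Tavenas2014_cor_3_37_holds : Tavenas2014_cor_3_37 :=
  Tavenas2014_cor_3_37_of_BCS21_29 (BCS1997_thm_21_29_holds ℚ)

end Literature.Computability.AlgebraicComplexity
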